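import Summits.QuantumFields.QCD.Theses.SpectralDefectExtinction
import Literature.MathematicalPhysics.QuantumFieldTheory.QCDPhaseQuenched
import Literature.MathematicalPhysics.QuantumFieldTheory.SpectralDefectDensity
import Literature.Barriers.QuantumFields.WilsonDeterminantMassSplitting
import Literature.Analysis.InnerProduct.CourantFischerBounds

/-!
# Bridge lemma H toward stub `coareaWegner` of line `Sketch` (skeleton "ResolventCell", gen 2) for
crux `SpectralDefectExtinction.WegnerEstimate` (item stmt-QuantumFields-8966):
Weyl's perturbation bound for Hermitian matrix families — sorted eigenvalues are Lipschitz,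
hence differentiable almost everywhere

The 1-D route (Lines/Sketch.md §gen 2) follows the decreasingly sorted eigenvalues
`Λ_i(t) = eigenvalues₀ (H t) i` of the Hermitian Wilson operator along a one-link circle
`H(t) = H₀ + cos t · H₁ + sin t · H₂`.  This file transfers the tree's operator-level Weyl
inequality (`Literature.Analysis.InnerProduct.abs_eigenvalues_sub_eigenvalues_le`, Horn–Johnson
Cor. 4.3.15) to Mathlib's matrix spectrum `Matrix.IsHermitian.eigenvalues₀` (which IS the sorted
operator spectrum of `toEuclideanLin`, by definition):

* `coareaWegner_abs_eigenvalues₀_sub_le` — `|Λ_i(A) − Λ_i(B)| ≤ c` whenever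
  `|re (u⋆ (A − B) u)| ≤ c Σ_p |u_p|²`;
* `coareaWegner_abs_eigenvalues₀_sub_le_of_entry` — entrywise form, `c = card n · max |(A − B)_{pq}|`;
* `coareaWegner_eigenvalues₀_lipschitz` / `coareaWegner_ae_differentiableAt_eigenvalues₀` — along a
  family with `K`-Lipschitz entries every `Λ_i` is `(card n · K)`-Lipschitz, so (Lebesgue/Rademacher,
  `LipschitzWith.ae_differentiableAt_real`) for a.e. `t` ALL `Λ_i` are differentiable at `t` — the
  hypothesis of the cluster Hellmann–Feynman theorem (bridge I, `coareaWegner_cluster_hellmannFeynman`);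
* `coareaWegner_trigFamily_hasDerivAt` / `coareaWegner_trigFamily_entry_lipschitz` — the
  trigonometric families `H₀ + cos t H₁ + sin t H₂` of the one-link circles have entrywise derivative
  `−sin t H₁ + cos t H₂` and Lipschitz entries.
-/

noncomputable section

namespace Summit.QuantumFields.QCD.Cruxes.WegnerEstimate.ResolventCell

open MeasureTheory Filter
open scoped Matrix BigOperators InnerProductSpace Topology NNReal
open Literature.MathematicalPhysics.QuantumLattice Literature.MathematicalPhysics.QuantumFieldTheory
  Literature.Probability.LatticeModels
open Literature.Analysis.InnerProduct (abs_eigenvalues_sub_eigenvalues_le)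
open Matrix
open scoped ComplexOrder

section General

variable {n : Type*} [Fintype n] [DecidableEq n]

/-- The quadratic form of `toEuclideanLin M` is the matrix quadratic form (up to conjugation):
`re ⟪toEuclideanLin M x, x⟫ = re ((ofLp x)⋆ M (ofLp x))`. -/
theorem coareaWegner_re_inner_toEuclideanLin (M : Matrix n n ℂ) (x : EuclideanSpace ℂ n) :
    RCLike.re ⟪Matrix.toEuclideanLin M x, x⟫_ℂ = (star (WithLp.ofLp x) ⬝ᵥ M.mulVec (WithLp.ofLp x)).re := by
  have h1 : ⟪Matrix.toEuclideanLin M x, x⟫_ℂ = star (star (WithLp.ofLp x) ⬝ᵥ M.mulVec (WithLp.ofLp x)) := by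
    rw [EuclideanSpace.inner_eq_star_dotProduct, Matrix.ofLp_toLpLin, Matrix.toLin'_apply, star_dotProduct,
      star_star, dotProduct_comm]
  rw [h1]
  exact Complex.conj_re _

/-- **Weyl's perturbation bound for Hermitian matrices (sorted spectrum).**  If the quadratic form of
`A − B` is bounded by `c`, `|re (u⋆ (A − B) u)| ≤ c · Σ_p |u_p|²` for all `u`, then the decreasingly
sorted eigenvalues satisfy `|Λ_i(A) − Λ_i(B)| ≤ c` for every `i`. -/
theorem coareaWegner_abs_eigenvalues₀_sub_le {A B : Matrix n n ℂ} (hA : A.IsHermitian)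
    (hB : B.IsHermitian) {c : ℝ}
    (hc : ∀ u : n → ℂ, |(star u ⬝ᵥ (A - B).mulVec u).re| ≤ c * ∑ p, ‖u p‖ ^ 2)
    (i : Fin (Fintype.card n)) :
    |hA.eigenvalues₀ i - hB.eigenvalues₀ i| ≤ c := by
  have hS : (Matrix.toEuclideanLin A).IsSymmetric := Matrix.isSymmetric_toEuclideanLin_iff.mpr hA
  have hT : (Matrix.toEuclideanLin B).IsSymmetric := Matrix.isSymmetric_toEuclideanLin_iff.mpr hB
  have hc' : ∀ x : EuclideanSpace ℂ n,
      |RCLike.re ⟪(Matrix.toEuclideanLin A - Matrix.toEuclideanLin B) x, x⟫_ℂ| ≤ c * ‖x‖ ^ 2 := by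
    intro x
    rw [← map_sub, coareaWegner_re_inner_toEuclideanLin, EuclideanSpace.norm_sq_eq]
    exact hc (WithLp.ofLp x)
  exact abs_eigenvalues_sub_eigenvalues_le hT hS finrank_euclideanSpace hc' i

omit [DecidableEq n] in
/-- The matrix quadratic form is bounded entrywise: if `|M_{pq}| ≤ δ` for all `p, q` (`δ ≥ 0`) then
`|re (u⋆ M u)| ≤ card n · δ · Σ_p |u_p|²` (Cauchy–Schwarz `(Σ |u_p|)² ≤ card n · Σ |u_p|²`). -/
theorem coareaWegner_abs_quadForm_le_of_entry (M : Matrix n n ℂ) {δ : ℝ} (hδ0 : 0 ≤ δ)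
    (hδ : ∀ p q, ‖M p q‖ ≤ δ) (u : n → ℂ) :
    |(star u ⬝ᵥ M.mulVec u).re| ≤ (Fintype.card n * δ) * ∑ p, ‖u p‖ ^ 2 := by
  calc |(star u ⬝ᵥ M.mulVec u).re| ≤ ‖star u ⬝ᵥ M.mulVec u‖ := Complex.abs_re_le_norm _
    _ ≤ ∑ p, ‖star u p * M.mulVec u p‖ := norm_sum_le _ _
    _ ≤ ∑ p, ‖u p‖ * (δ * ∑ q, ‖u q‖) := by
        refine Finset.sum_le_sum fun p _ => ?_
        rw [norm_mul, Pi.star_apply, norm_star]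
        refine mul_le_mul_of_nonneg_left ?_ (norm_nonneg _)
        calc ‖M.mulVec u p‖ = ‖∑ q, M p q * u q‖ := rfl
          _ ≤ ∑ q, ‖M p q * u q‖ := norm_sum_le _ _
          _ ≤ ∑ q, δ * ‖u q‖ := Finset.sum_le_sum fun q _ => by
              rw [norm_mul]; exact mul_le_mul_of_nonneg_right (hδ p q) (norm_nonneg _)
          _ = δ * ∑ q, ‖u q‖ := by rw [Finset.mul_sum]
    _ = δ * (∑ p, ‖u p‖) ^ 2 := by rw [← Finset.sum_mul, sq]; ring
    _ ≤ δ * (Fintype.card n * ∑ p, ‖u p‖ ^ 2) := by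
        refine mul_le_mul_of_nonneg_left ?_ hδ0
        have h := sq_sum_le_card_mul_sum_sq (s := Finset.univ) (f := fun p => ‖u p‖)
        simpa using h
    _ = (Fintype.card n * δ) * ∑ p, ‖u p‖ ^ 2 := by ring

/-- **Weyl, entrywise form.**  If `|(A − B)_{pq}| ≤ δ` for all `p, q` (`δ ≥ 0`) then
`|Λ_i(A) − Λ_i(B)| ≤ card n · δ` for all sorted indices `i`. -/
theorem coareaWegner_abs_eigenvalues₀_sub_le_of_entry {A B : Matrix n n ℂ} (hA : A.IsHermitian)
    (hB : B.IsHermitian) {δ : ℝ} (hδ0 : 0 ≤ δ) (hδ : ∀ p q, ‖(A - B) p q‖ ≤ δ)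
    (i : Fin (Fintype.card n)) :
    |hA.eigenvalues₀ i - hB.eigenvalues₀ i| ≤ Fintype.card n * δ :=
  coareaWegner_abs_eigenvalues₀_sub_le hA hB (fun u => coareaWegner_abs_quadForm_le_of_entry _ hδ0 hδ u) i

/-- **Sorted eigenvalues of a Lipschitz Hermitian family are Lipschitz.**  If every entry of
`t ↦ H(t)` is `K`-Lipschitz then every sorted eigenvalue `t ↦ Λ_i(H(t))` is `(card n · K)`-Lipschitz. -/
theorem coareaWegner_eigenvalues₀_lipschitz (H : ℝ → Matrix n n ℂ) (hH : ∀ t, (H t).IsHermitian)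
    {K : ℝ≥0} (hK : ∀ s t p q, ‖H s p q - H t p q‖ ≤ K * |s - t|) (i : Fin (Fintype.card n)) :
    LipschitzWith (Fintype.card n * K) (fun t => (hH t).eigenvalues₀ i) := by
  refine LipschitzWith.of_dist_le_mul fun s t => ?_
  rw [Real.dist_eq, Real.dist_eq, NNReal.coe_mul, NNReal.coe_natCast, mul_assoc]
  exact coareaWegner_abs_eigenvalues₀_sub_le_of_entry (hH s) (hH t) (by positivity)
    (fun p q => by rw [Matrix.sub_apply]; exact hK s t p q) i

/-- **Almost every `t` is a point of differentiability of ALL sorted eigenvalues** of a Lipschitz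
Hermitian family (Lebesgue's theorem on Lipschitz functions of one real variable, for each of the
finitely many `Λ_i`) — the hypothesis of the cluster Hellmann–Feynman theorem
`coareaWegner_cluster_hellmannFeynman`. -/
theorem coareaWegner_ae_differentiableAt_eigenvalues₀ (H : ℝ → Matrix n n ℂ)
    (hH : ∀ t, (H t).IsHermitian) {K : ℝ≥0} (hK : ∀ s t p q, ‖H s p q - H t p q‖ ≤ K * |s - t|) :
    ∀ᵐ t : ℝ, ∀ i : Fin (Fintype.card n), DifferentiableAt ℝ (fun t => (hH t).eigenvalues₀ i) t :=
  ae_all_iff.2 fun i => (coareaWegner_eigenvalues₀_lipschitz H hH hK i).ae_differentiableAt_real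

/-- Sorted eigenvalues of a Lipschitz Hermitian family are continuous. -/
theorem coareaWegner_continuous_eigenvalues₀ (H : ℝ → Matrix n n ℂ) (hH : ∀ t, (H t).IsHermitian)
    {K : ℝ≥0} (hK : ∀ s t p q, ‖H s p q - H t p q‖ ≤ K * |s - t|) (i : Fin (Fintype.card n)) :
    Continuous fun t => (hH t).eigenvalues₀ i :=
  (coareaWegner_eigenvalues₀_lipschitz H hH hK i).continuous

end General

/-! ### Trigonometric (one-link circle) families `H₀ + cos t · H₁ + sin t · H₂` -/

/-- Entrywise derivative of a trigonometric matrix family. -/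
theorem coareaWegner_trigFamily_hasDerivAt {n : Type*} (H₀ H₁ H₂ : Matrix n n ℂ) (t : ℝ) (p q : n) :
    HasDerivAt (fun s : ℝ => (H₀ + ((Real.cos s : ℝ) : ℂ) • H₁ + ((Real.sin s : ℝ) : ℂ) • H₂) p q)
      ((((-Real.sin t : ℝ) : ℂ) • H₁ + ((Real.cos t : ℝ) : ℂ) • H₂) p q) t := by
  simp only [Matrix.add_apply, Matrix.smul_apply, smul_eq_mul]
  have h1 : HasDerivAt (fun s : ℝ => ((Real.cos s : ℝ) : ℂ)) ((-Real.sin t : ℝ) : ℂ) t :=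
    (Real.hasDerivAt_cos t).ofReal_comp
  have h2 : HasDerivAt (fun s : ℝ => ((Real.sin s : ℝ) : ℂ)) ((Real.cos t : ℝ) : ℂ) t :=
    (Real.hasDerivAt_sin t).ofReal_comp
  have h : HasDerivAt
      (fun s : ℝ => H₀ p q + ((Real.cos s : ℝ) : ℂ) * H₁ p q + ((Real.sin s : ℝ) : ℂ) * H₂ p q)
      (0 + ((-Real.sin t : ℝ) : ℂ) * H₁ p q + ((Real.cos t : ℝ) : ℂ) * H₂ p q) t :=
    ((hasDerivAt_const t (H₀ p q)).fun_add (h1.mul_const (H₁ p q))).fun_add (h2.mul_const (H₂ p q))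
  rw [zero_add] at h
  exact h

/-- Entries of a trigonometric matrix family are Lipschitz with constant `|H₁ pq| + |H₂ pq|`. -/
theorem coareaWegner_trigFamily_entry_lipschitz {n : Type*} (H₀ H₁ H₂ : Matrix n n ℂ) (p q : n) (s t : ℝ) :
    ‖(H₀ + ((Real.cos s : ℝ) : ℂ) • H₁ + ((Real.sin s : ℝ) : ℂ) • H₂) p q -
        (H₀ + ((Real.cos t : ℝ) : ℂ) • H₁ + ((Real.sin t : ℝ) : ℂ) • H₂) p q‖ ≤
      (‖H₁ p q‖ + ‖H₂ p q‖) * |s - t| := by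
  set f : ℝ → ℂ := fun s => (H₀ + ((Real.cos s : ℝ) : ℂ) • H₁ + ((Real.sin s : ℝ) : ℂ) • H₂) p q with hf
  have hd : ∀ r, HasDerivAt f ((((-Real.sin r : ℝ) : ℂ) • H₁ + ((Real.cos r : ℝ) : ℂ) • H₂) p q) r :=
    fun r => coareaWegner_trigFamily_hasDerivAt H₀ H₁ H₂ r p q
  have hlip : LipschitzWith (‖H₁ p q‖₊ + ‖H₂ p q‖₊) f := by
    refine lipschitzWith_of_nnnorm_deriv_le (fun r => (hd r).differentiableAt) fun r => ?_
    rw [(hd r).deriv]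
    rw [← NNReal.coe_le_coe, coe_nnnorm, NNReal.coe_add, coe_nnnorm, coe_nnnorm]
    simp only [Matrix.add_apply, Matrix.smul_apply, smul_eq_mul]
    refine (norm_add_le _ _).trans (add_le_add ?_ ?_)
    · rw [norm_mul, Complex.norm_real]
      calc ‖-Real.sin r‖ * ‖H₁ p q‖ ≤ 1 * ‖H₁ p q‖ := by
            refine mul_le_mul_of_nonneg_right ?_ (norm_nonneg _)
            rw [norm_neg, Real.norm_eq_abs]; exact Real.abs_sin_le_one r
        _ = ‖H₁ p q‖ := one_mul _
    · rw [norm_mul, Complex.norm_real]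
      calc ‖Real.cos r‖ * ‖H₂ p q‖ ≤ 1 * ‖H₂ p q‖ := by
            refine mul_le_mul_of_nonneg_right ?_ (norm_nonneg _)
            rw [Real.norm_eq_abs]; exact Real.abs_cos_le_one r
        _ = ‖H₂ p q‖ := one_mul _
  have h := hlip.dist_le_mul s t
  rw [dist_eq_norm, Real.dist_eq, NNReal.coe_add, coe_nnnorm, coe_nnnorm] at h
  exact h

/-- A uniform entrywise Lipschitz constant for a trigonometric family:
`K = Σ_{p,q} (|H₁ pq| + |H₂ pq|)`. -/
theorem coareaWegner_trigFamily_lipschitz_const {n : Type*} [Fintype n] (H₀ H₁ H₂ : Matrix n n ℂ)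
    (s t : ℝ) (p q : n) :
    ‖(H₀ + ((Real.cos s : ℝ) : ℂ) • H₁ + ((Real.sin s : ℝ) : ℂ) • H₂) p q -
        (H₀ + ((Real.cos t : ℝ) : ℂ) • H₁ + ((Real.sin t : ℝ) : ℂ) • H₂) p q‖ ≤
      ((∑ p' : n, ∑ q' : n, (‖H₁ p' q'‖₊ + ‖H₂ p' q'‖₊) : ℝ≥0) : ℝ) * |s - t| := by
  refine (coareaWegner_trigFamily_entry_lipschitz H₀ H₁ H₂ p q s t).trans
    (mul_le_mul_of_nonneg_right ?_ (abs_nonneg _))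
  push_cast
  calc ‖H₁ p q‖ + ‖H₂ p q‖ ≤ ∑ q' : n, (‖H₁ p q'‖ + ‖H₂ p q'‖) :=
        Finset.single_le_sum (f := fun q' => ‖H₁ p q'‖ + ‖H₂ p q'‖) (fun _ _ => by positivity)
          (Finset.mem_univ q)
    _ ≤ ∑ p' : n, ∑ q' : n, (‖H₁ p' q'‖ + ‖H₂ p' q'‖) :=
        Finset.single_le_sum (f := fun p' => ∑ q' : n, (‖H₁ p' q'‖ + ‖H₂ p' q'‖))
          (fun _ _ => Finset.sum_nonneg fun _ _ => by positivity) (Finset.mem_univ p)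

/-- **Along a one-link circle, almost every `t` is a point of differentiability of all sorted
eigenvalues**, and each `Λ_i` is Lipschitz (hence continuous) — for the trigonometric Hermitian
families `H(t) = H₀ + cos t · H₁ + sin t · H₂`. -/
theorem coareaWegner_trigFamily_ae_differentiableAt {n : Type*} [Fintype n] [DecidableEq n]
    (H₀ H₁ H₂ : Matrix n n ℂ)
    (hH : ∀ t : ℝ, (H₀ + ((Real.cos t : ℝ) : ℂ) • H₁ + ((Real.sin t : ℝ) : ℂ) • H₂).IsHermitian) :
    (∀ i, LipschitzWith (Fintype.card n * ∑ p' : n, ∑ q' : n, (‖H₁ p' q'‖₊ + ‖H₂ p' q'‖₊))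
      (fun t => (hH t).eigenvalues₀ i)) ∧
    ∀ᵐ t : ℝ, ∀ i : Fin (Fintype.card n), DifferentiableAt ℝ (fun t => (hH t).eigenvalues₀ i) t :=
  ⟨fun i => coareaWegner_eigenvalues₀_lipschitz _ hH
      (fun s t p q => coareaWegner_trigFamily_lipschitz_const H₀ H₁ H₂ s t p q) i,
    coareaWegner_ae_differentiableAt_eigenvalues₀ _ hH
      (fun s t p q => coareaWegner_trigFamily_lipschitz_const H₀ H₁ H₂ s t p q)⟩

end Summit.QuantumFields.QCD.Cruxes.WegnerEstimate.ResolventCell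

end
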